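import Summits.AtomisticToContinuum.HydrodynamicLimit.Theorems.JParityClosureRateFloorStaticFloorRung0Window
import Summits.AtomisticToContinuum.HydrodynamicLimit.Theorems.JParityClosureEvenStressEnskogPlateauWindow
import Literature.MathematicalPhysics.KineticTheory.HardSphereCanonicalTwoClusterLimit
import Literature.MathematicalPhysics.KineticTheory.HardSphereCanonicalLabelLaw
import HarnessLib

/-!
# Line `Sketch` of crux `RateFloor`, rung 0: the static opacity floor S7b₀, CLOSED
# (helper file, `--supports stmt-AtomisticToContinuum-13080`)

The registered stub `stub_staticOpacityFloorRung0` (S7b₀ = S7b at constant profiles / global equilibrium,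
`Stubs.stub_staticOpacityFloorRung0` of the line `Sketch` verbatim) as an unconditional tree theorem.  It is the pure
composition of three landed pieces:

* `RateFloorStaticFloor.staticOpacityFloorRung0_of_plateauWindow` (this crux, c2 lane): S7b₀ from the WINDOWED four-label
  decorrelation plateau `PlateauWindow` of the canonical hard-sphere Gibbs measure `posGibbsMeasure 1 ε_N (N+1)`;
* `EvenStressEnskog.plateauWindow_of_twoCluster_labelLaw` (sibling crux stmt-AtomisticToContinuum-13079, line
  `liouville_continuity_pins_universal_contact_value`): `PlateauWindow` from the two-cluster factorisation of the canonical
  correlation functions at contact scale (P-a) and the `vcan`-density of the labelled two- and four-point laws (P-b1);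
* the Literature theorems `vcan_append_sub_mul_le` (P-a; Ruelle's Kirkwood–Salsburg method in the canonical ensemble) and
  `integral_labelLaw_eq_integral_mul_vcan` (P-b1), whose statements are textually the two hypotheses of the previous item.

Nothing else is proved here; the lead composes this with S7a₀ (`stub_noBurstsRung0`) to close `RateFloor` at global equilibrium.
-/

noncomputable section

open scoped BigOperators Topology ENNReal Classical
open MeasureTheory Set Filter Function
open Literature.Analysis.FluidPDE Literature.MathematicalPhysics.KineticTheory

namespace Summit.AtomisticToContinuum.HydrodynamicLimit.Theorems

namespace RateFloorStaticFloor

open RateFloorLine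

/-- **S7b₀ · the static opacity floor of line `Sketch` at rung 0 (constant profiles), unconditionally** (registered stub
`stub_staticOpacityFloorRung0` of crux stmt-AtomisticToContinuum-13080, `Stubs.stub_staticOpacityFloorRung0` verbatim):
`staticOpacityFloorRung0_of_plateauWindow` fed with the windowed plateau
`EvenStressEnskog.plateauWindow_of_twoCluster_labelLaw vcan_append_sub_mul_le integral_labelLaw_eq_integral_mul_vcan`. [folklore] -/
theorem stub_staticOpacityFloorRung0 :
    ∃ g₃ : ℝ, 0 < g₃ ∧ ∀ (a θ : ℝ) (u : Literature.MathematicalPhysics.KineticTheory.V3), 0 < a → 0 < θ → ∃ σ₀ : ℝ, 0 < σ₀ ∧ ∀ σ : ℝ, 0 < σ → σ < σ₀ → ∀ Φ : (N : ℕ) → Literature.Analysis.FluidPDE.HardSphereFlow (Literature.Analysis.FluidPDE.Torus.geometry (Fin 3)) (Literature.MathematicalPhysics.KineticTheory.hsDiameter σ N) (N + 1), ∀ τ : ℝ, 0 < τ → ∀ χ : ℝ × UnitAddTorus (Fin 3) → ℝ, Continuous χ → (∀ p, 0 ≤ χ p) → ∀ Ξ : EuclideanSpace ℝ (Fin 3)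 × EuclideanSpace ℝ (Fin 3) × EuclideanSpace ℝ (Fin 3) → ℝ, Continuous Ξ → (∀ q, 0 ≤ Ξ q) → (∃ C : ℝ, ∀ q, Ξ q ≤ C) → ∀ η δ : ℝ, 0 < η → 0 < δ → ∃ r₀ : ℝ, 0 < r₀ ∧ ∀ r : ℝ, 0 < r → r < r₀ → ∀ A : ℝ, 0 < A → ∀ b : ℝ, 1 / 3 ≤ b → b ≤ 1 → ∃ N₀ : ℕ, ∀ N : ℕ, N₀ ≤ N → let ε := Literature.MathematicalPhysics.KineticTheory.hsDiameter σ N; let G := Literature.Analysis.FluidPDE.Torus.geometry (Fin 3); let γ := fun z (s : ℝ) => (Φ N).flow s z; let bx : UnitAddTorus (Fin 3) → UnitAddTorus (Fin 3) → ℝ := fun x y => 3 / (Real.pi * r ^ 3) * max (1 - Literature.Analysis.FluidPDE.Torus.euclidDist x y / r) 0; let Θ := fun (Ξ : EuclideanSpace ℝ (Fin 3) × EuclideanSpace ℝ (Fin 3) × EuclideanSpace ℝ (Fin 3) → ℝ) (v w : EuclideanSpace ℝ (Fin 3)) => ∫ ω : Metric.sphere (0 : EuclideanSpace ℝ (Fin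 3)) 1, Ξ ((ω : EuclideanSpace ℝ (Fin 3)), v, w) * Literature.MathematicalPhysics.KineticTheory.hardSphereKernel (w, v) ω ∂Literature.MathematicalPhysics.KineticTheory.sphereMeasure; let B := fun Ξ z s (x₀ : UnitAddTorus (Fin 3)) => ∫ p, bx p.1.1 x₀ * bx p.2.1 x₀ * Θ Ξ p.1.2 p.2.2 ∂((Literature.Analysis.FluidPDE.empiricalMeasure (γ z s)).prod (Literature.Analysis.FluidPDE.empiricalMeasure (γ z s))); let SW := fun (z : Literature.Analysis.FluidPDE.Config (N + 1) (Fin 3) Literature.MathematicalPhysics.KineticTheory.T3) => lineSW ε (windowLenB A b N) τ (γ z) (fun u x y v w => χ (u, x) * Ξ (ε⁻¹ • G.sepVec x y, v, w)); Literature.MathematicalPhysics.KineticTheory.localGibbsLaw σ (fun _ => a) (fun _ => u) (fun _ => θ) N (Φ N) {z | SW z < g₃ * σ ^ 3 * (∫ s in Set.Icc (0 : ℝ) τ, ∫ x : UnitAddTorus (Fin 3), χ (s, x) * B Ξ z s x) - η} ≤ ENNReal.ofReal δ :=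
  staticOpacityFloorRung0_of_plateauWindow
    (EvenStressEnskog.plateauWindow_of_twoCluster_labelLaw vcan_append_sub_mul_le integral_labelLaw_eq_integral_mul_vcan)

end RateFloorStaticFloor

end Summit.AtomisticToContinuum.HydrodynamicLimit.Theorems

end
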